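import Summits.QuantumFields.BalabanUV.InfraRed.StrongCouplingStaggerForest
import Summits.QuantumFields.BalabanUV.InfraRed.StrongCouplingForestGaugeFixing

/-!
# The forest door ASSEMBLED: `ForestGaugeFixing` (F2) and `FrozenForestClustering` (F3) give `ForestDobrushinDoor`
observatory of the non-perturbative crossover; no mass-gap claim.

Leaf (24) `InfraRed/StrongCouplingForestGauge` typed the forest door as ONE lumped hypothesis schema
`ForestDobrushinDoor` («F2 + F3»).  This leaf separates the two rungs and PROVES the lumping:

* **F3, typed** — `FrozenForestClustering` (`@[conjecture]`, a HYPOTHESIS SCHEMA, nothing asserted): Föllmer's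
  covariance estimate for a Gibbs measure under Dobrushin's condition [cite: Follmer1988, Ch. I Theorem (2.13)]
  [cite: Georgii2011, Thm. 8.20, Remark 8.26], run — exactly as the tree's PROVED
  `wilson_torusClustering_of_oneLinkKRModulus` runs it for the full torus Wilson state — on the FROZEN Wilson measure
  `frozenWilsonMeasure ρ F β` of leaf (26) (the links of `F` gauge-fixed to `1`,
  [cite: Creutz2022, Ch. 9, eq. (9.19), p. 44]), whose one-link Dobrushin rows are `(|β|/N)·K·forestRow F e ≤ (|β|/N)·K·D`
  when `ForestRowBound F D` (leaf (24)) instead of `18 (|β|/N) K`: for bounded measurable local observables ONE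
  constant bounds the frozen covariances by `C e^{−m‖x‖_∞}`, `m = krRate c`, on all large odd tori.  It is an
  obligation node for a prover seat (the tree's Dobrushin files are over an arbitrary finite site set; the work is
  the frozen specification on `{e // e ∉ F}`), NOT a citation.
* **The assembly, PROVED**: `exponentialClustering_of_frozen` — F2 (gauge-invariant species have the same
  expectations under the Wilson and the frozen measure; products of species and their translates are gauge
  invariant: `isGaugeInvariant_toTorusObservable`, `isZdGaugeInvariant_mul_configShift`) + F3 + translation
  invariance of the torus state (`wilsonMeasure_map_torusConfigShift`) give `ExponentialClustering` at rate
  `krRate c` whenever `D (|β|/N) K ≤ c < 1`; `forestDobrushinDoor_of_gaugeFixing_of_frozenClustering` — for `SU(2)` in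
  Wilson units this IS leaf (24)'s `ForestDobrushinDoor`; and the 4/15 what-if with its three hypotheses apart:
  `su2_strongCouplingFront_whatIf15_of_rungs : ForestGaugeFixing ρ₂ → FrozenForestClustering →
  QuarterModulusUpTo (4/15) → (0 ≤ β₀W < 4/15 → StrongCouplingFront (fundamentalLatticeRep 2) (β₀W/2))`.

What is NOT claimed: neither F2 nor F3 nor F4 is proved here; no row of the strong-coupling front moves (owned number
unchanged, `β_W < 2/9`); `4/15` stays a what-if; nothing about a mass gap.
-/

noncomputable section

open MeasureTheory
open Literature.MathematicalPhysics.QuantumFieldTheory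
open Literature.MathematicalPhysics.QuantumLattice
open Literature.Probability.LatticeModels (Torus.proj)
open Literature.MathematicalPhysics.QuantumFieldTheory.Balaban1983to89
open Literature.MathematicalPhysics.QuantumFieldTheory.Balaban1983to89.StrongCouplingDobrushinWindow
open Literature.MathematicalPhysics.QuantumFieldTheory.Balaban1983to89.StrongCouplingTorusWindow
open Summit.QuantumFields.BalabanUV.InfraRed.StrongCouplingForestGauge
open Summit.QuantumFields.BalabanUV.InfraRed.StrongCouplingStaggerForest
open Summit.QuantumFields.BalabanUV.InfraRed.StrongCouplingForestGaugeFixing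

namespace Summit.QuantumFields.BalabanUV.InfraRed.StrongCouplingForestDoorAssembly

/-! ### §1 Torus restrictions of gauge-invariant observables are gauge invariant -/

section GaugeInvariance

variable {d : ℕ} {G : Type*} [Group G]

/-- The torus restriction of a gauge-invariant observable of `ℤ^d` is gauge invariant on the torus. [folklore] -/
theorem isGaugeInvariant_toTorusObservable {α : Type*} {F : LGConfig d G → α} (hF : IsZdGaugeInvariant F)
    (L : ℕ) : IsGaugeInvariant (toTorusObservable L F) := by
  intro γ W
  -- the periodic lift intertwines the gauge actions (the tree's `torusLift_gaugeTransform` of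
  -- `Balaban1983to89/InfiniteVolumeSufficientXIX`, re-derived inline to keep that module out of this leaf's cone)
  have hlift : torusLift L (gaugeTransform γ W) = gaugeTransformZd (γ ∘ Torus.proj L) (torusLift L W) := by
    funext e
    simp only [torusLift, Function.comp_apply, torusEdge, gaugeTransform, gaugeTransformZd, Site.shift,
      torusProj_add_single, Int.cast_one]
  simp only [toTorusObservable, Function.comp_apply, hlift]
  exact hF _ _

variable [MeasurableSpace G]

/-- Translation conjugates gauge transformations by the translated gauge function. [folklore] -/
theorem configShift_gaugeTransformZd_eq (x : Literature.Probability.LatticeModels.Site d)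
    (g : Literature.Probability.LatticeModels.Site d → G) (U : LGConfig d G) :
    configShift x (gaugeTransformZd g U) = gaugeTransformZd (fun y => g (y - x)) (configShift x U) := by
  funext e
  simp only [configShift_apply, gaugeTransformZd]
  congr 2
  abel_nf

/-- A translate of a gauge-invariant observable is gauge invariant. [folklore] -/
theorem isZdGaugeInvariant_comp_configShift_eq {α : Type*} {F : LGConfig d G → α} (hF : IsZdGaugeInvariant F)
    (x : Literature.Probability.LatticeModels.Site d) : IsZdGaugeInvariant (F ∘ configShift x) := by
  intro g U
  simp only [Function.comp_apply, configShift_gaugeTransformZd_eq]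
  exact hF _ _

/-- The product of a gauge-invariant observable with a translate of another is gauge invariant. [folklore] -/
theorem isZdGaugeInvariant_mul_configShift {F₁ F₂ : LGConfig d G → ℝ} (h₁ : IsZdGaugeInvariant F₁)
    (h₂ : IsZdGaugeInvariant F₂) (x : Literature.Probability.LatticeModels.Site d) :
    IsZdGaugeInvariant (fun U => F₁ U * F₂ (configShift x U)) := by
  intro g U
  simp only
  rw [h₁ g U, configShift_gaugeTransformZd_eq, h₂]

end GaugeInvariance

/-! ### §2 Rung F3 typed: Dobrushin–Föllmer clustering of the FROZEN Wilson measure -/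

/-- **F3 — FROZEN-FOREST CLUSTERING (typed rung, HYPOTHESIS SCHEMA; an obligation node, nothing asserted).**
For `SU(N)`, `d = 4`: given frozen link sets `Fs S` on the tori `(ℤ/(2S+1))⁴`, `S ≥ S₀`, with
`ForestRowBound (Fs S) D`, if `(|β|/N)·6 ≤ R`, `OneLinkKRModulus N R K` and `D (|β|/N) K ≤ c < 1`, then for every pair
of bounded measurable local observables ONE constant `C` bounds the connected correlation of `F₁` and `F₂ ∘ θ_x` under
the frozen Wilson measure `frozenWilsonMeasure (fundamentalRep (Fin N)) (Fs S) β` by `C e^{−krRate c · ‖x‖_∞}` for all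
`S ≥ S₀`, `S ≥ 1`, `2‖x‖_∞ < 2S+1` — Föllmer's covariance estimate (Ch. I Thm. (2.13)) for the frozen specification,
whose Dobrushin row at a dynamic link `e` is `(|β|/N) K · forestRow (Fs S) e`; the full-torus case `D = 18` is the
tree's proved `wilson_torusClustering_of_oneLinkKRModulus`. [cite: Follmer1988, Ch. I Theorem (2.13)]
[cite: Georgii2011, Thm. 8.20, Remark 8.26] [cite: Creutz2022, Ch. 9, eq. (9.19), p. 44] -/
@[conjecture]
def FrozenForestClustering : Prop :=
  ∀ (N D : ℕ), 1 ≤ N → ∀ (Fs : (S : ℕ) → Finset (Edge 4 (2 * S + 1))) (S₀ : ℕ),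
    (∀ S, S₀ ≤ S → ForestRowBound (Fs S) D) →
    ∀ (β R K c : ℝ), 0 ≤ K → |β| / N * 6 ≤ R → OneLinkKRModulus N R K → (D : ℝ) * (|β| / N) * K ≤ c → c < 1 →
    ∀ (F₁ F₂ : LGConfig 4 (Matrix.specialUnitaryGroup (Fin N) ℂ) → ℝ),
      Literature.MathematicalPhysics.QuantumLattice.IsLocalObservable F₁ →
      Literature.MathematicalPhysics.QuantumLattice.IsLocalObservable F₂ → Measurable F₁ → Measurable F₂ →
      (∃ C, ∀ U, |F₁ U| ≤ C) → (∃ C, ∀ U, |F₂ U| ≤ C) →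
      ∃ C : ℝ, ∀ S : ℕ, S₀ ≤ S → 1 ≤ S → ∀ x : Literature.Probability.LatticeModels.Site 4,
        2 * ‖x‖ < ((2 * S + 1 : ℕ) : ℝ) →
        |(∫ V, toTorusObservable (2 * S + 1) (fun U => F₁ U * F₂ (configShift x U)) V
              ∂(frozenWilsonMeasure (d := 4) (L := 2 * S + 1) (fundamentalRep (Fin N)) (Fs S) β)) -
            (∫ V, toTorusObservable (2 * S + 1) F₁ V
                ∂(frozenWilsonMeasure (d := 4) (L := 2 * S + 1) (fundamentalRep (Fin N)) (Fs S) β)) *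
              ∫ V, toTorusObservable (2 * S + 1) (F₂ ∘ configShift x) V
                ∂(frozenWilsonMeasure (d := 4) (L := 2 * S + 1) (fundamentalRep (Fin N)) (Fs S) β)| ≤
          C * Real.exp (-(krRate c * ‖x‖))

/-! ### §3 The assembly -/

/-- **F2 + F3 ⇒ exponential clustering of the Wilson torus states** (`SU(N)`, `d = 4`): with ranked forests of row
bound `D` on all large odd tori, forest gauge fixing (F2) and frozen-forest clustering (F3), every `β` with
`(|β|/N)·6 ≤ R`, `OneLinkKRModulus N R K`, `D (|β|/N) K ≤ c < 1` has `ExponentialClustering (fundamentalRep (Fin N)) β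
(krRate c)`.  Proof: species, their translates and their products are gauge invariant, so F2 moves all three
expectations of the connected correlation to the frozen measure, where F3 bounds it; translation invariance of the
torus state identifies `⟨B ∘ θ⟩ = ⟨B⟩`. [cite: Creutz2022, Ch. 9, eq. (9.19), p. 44]
[cite: Follmer1988, Ch. I Theorem (2.13)] -/
theorem exponentialClustering_of_frozen {N : ℕ} (hN : 1 ≤ N)
    (hF2 : ForestGaugeFixing (G := Matrix.specialUnitaryGroup (Fin N) ℂ) (fundamentalRep (Fin N)))
    (hF3 : FrozenForestClustering) {D : ℕ} (Fs : (S : ℕ) → Finset (Edge 4 (2 * S + 1)))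
    (rks : (S : ℕ) → Site 4 (2 * S + 1) → ℕ) (S₀ : ℕ)
    (hforest : ∀ S, S₀ ≤ S → IsRankedForest (Fs S) (rks S) ∧ ForestRowBound (Fs S) D)
    {β R K c : ℝ} (hK : 0 ≤ K) (hR : |β| / N * 6 ≤ R) (hmod : OneLinkKRModulus N R K)
    (hc : (D : ℝ) * (|β| / N) * K ≤ c) (hc1 : c < 1) :
    CrossoverLedger.ExponentialClustering (G := Matrix.specialUnitaryGroup (Fin N) ℂ) (fundamentalRep (Fin N)) β
      (krRate c) := by
  refine ⟨krRate_pos hc1, fun A B => ?_⟩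
  obtain ⟨C, hC⟩ := hF3 N D hN Fs S₀ (fun S hS => (hforest S hS).2) β R K c hK hR hmod hc hc1
    A.F B.F ⟨A.supp, A.isCylinder⟩ ⟨B.supp, B.isCylinder⟩ A.measurable B.measurable A.bounded B.bounded
  refine ⟨C, max S₀ 1, fun S hS n hn => ?_⟩
  have hS₀ : S₀ ≤ S := le_of_max_le_left hS
  have hS1 : 1 ≤ S := le_of_max_le_right hS
  set x : Literature.Probability.LatticeModels.Site 4 := -Pi.single (0 : Fin 4) (n : ℤ) with hxdef
  have hxn : ‖x‖ = n := norm_neg_single_natCast n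
  have hx2 : 2 * ‖x‖ < ((2 * S + 1 : ℕ) : ℝ) := by
    rw [hxn]; push_cast
    have : (n : ℝ) ≤ S := by exact_mod_cast hn
    linarith
  have h := hC S hS₀ hS1 x hx2
  rw [hxn] at h
  -- the Wilson state of this torus is a probability measure; the forest of this torus is ranked
  set μ := wilsonMeasure (d := 4) (L := 2 * S + 1) (fundamentalRep (Fin N)) β with hμ
  have hcont : Continuous ⇑(fundamentalRep (Fin N)) := (fundamentalLatticeRep N).continuous
  haveI : IsProbabilityMeasure μ := isProbabilityMeasure_wilsonMeasure _ hcont β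
  have hrk : IsRankedForest (Fs S) (rks S) := (hforest S hS₀).1
  -- F2 on a bounded measurable gauge-invariant torus observable
  have key : ∀ Φ : GaugeConfig 4 (2 * S + 1) (Matrix.specialUnitaryGroup (Fin N) ℂ) → ℝ,
      IsGaugeInvariant Φ → Measurable Φ → (∃ M : ℝ, ∀ V, |Φ V| ≤ M) →
        ∫ V, Φ V ∂μ =
          ∫ V, Φ V ∂(frozenWilsonMeasure (d := 4) (L := 2 * S + 1) (fundamentalRep (Fin N)) (Fs S) β) := by
    intro Φ hΦ hΦm hM
    obtain ⟨M, hM⟩ := hM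
    exact hF2 hcont 4 (2 * S + 1) (Fs S) (rks S) hrk β Φ hΦ
      (Integrable.of_bound hΦm.aestronglyMeasurable M (ae_of_all _ fun V => by
        rw [Real.norm_eq_abs]; exact hM V))
  obtain ⟨M₁, hM₁⟩ := A.bounded
  obtain ⟨M₂, hM₂⟩ := B.bounded
  have hAi : IsGaugeInvariant (toTorusObservable (2 * S + 1) A.F) :=
    isGaugeInvariant_toTorusObservable A.gaugeInvariant _
  have hBxi : IsGaugeInvariant (toTorusObservable (2 * S + 1) (B.F ∘ configShift x)) :=
    isGaugeInvariant_toTorusObservable (isZdGaugeInvariant_comp_configShift_eq B.gaugeInvariant x) _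
  have hABi : IsGaugeInvariant (toTorusObservable (2 * S + 1) (fun U => A.F U * B.F (configShift x U))) :=
    isGaugeInvariant_toTorusObservable (isZdGaugeInvariant_mul_configShift A.gaugeInvariant B.gaugeInvariant x) _
  have hAm : Measurable (toTorusObservable (2 * S + 1) A.F) := A.measurable.comp (measurable_torusLift _)
  have hBxm : Measurable (toTorusObservable (2 * S + 1) (B.F ∘ configShift x)) :=
    (B.measurable.comp (configShift x).measurable).comp (measurable_torusLift _)
  have hABm : Measurable (toTorusObservable (2 * S + 1) (fun U => A.F U * B.F (configShift x U))) :=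
    (A.measurable.mul (B.measurable.comp (configShift x).measurable)).comp (measurable_torusLift _)
  have hMA : ∀ V, |toTorusObservable (2 * S + 1) A.F V| ≤ M₁ := fun V => hM₁ _
  have hMBx : ∀ V, |toTorusObservable (2 * S + 1) (B.F ∘ configShift x) V| ≤ M₂ := fun V => hM₂ _
  have hMAB : ∀ V, |toTorusObservable (2 * S + 1) (fun U => A.F U * B.F (configShift x U)) V| ≤ M₁ * M₂ :=
    fun V => abs_mul_le_of_abs_le hMA hMBx V
  have e1 := key _ hABi hABm ⟨M₁ * M₂, hMAB⟩
  have e2 := key _ hAi hAm ⟨M₁, hMA⟩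
  have e3 := key _ hBxi hBxm ⟨M₂, hMBx⟩
  -- translation invariance of the torus state: `⟨B ∘ θ_x⟩ = ⟨B⟩`
  have htrans : ∫ V, toTorusObservable (2 * S + 1) (B.F ∘ configShift x) V ∂μ =
      ∫ V, toTorusObservable (2 * S + 1) B.F V ∂μ := by
    rw [toTorusObservable_comp_configShift]
    simp only [Function.comp_apply]
    rw [← integral_map_equiv, hμ, wilsonMeasure_map_torusConfigShift]
  rw [← e1, ← e2, ← e3, htrans] at h
  exact h

/-- **F2 + F3 ⇒ the forest door of leaf (24)** (`SU(2)`, Wilson units): `ForestGaugeFixing (fundamentalRep (Fin 2))`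
and `FrozenForestClustering` give `ForestDobrushinDoor` — for every `D`, `EventualForestRowBound D`,
`OneLinkKRModulusSU2 β₀W K₂` and `D β₀W K₂ < 1` put the strong-coupling front at `β₀W` (tree coupling `β₀W/2`), with
the single rate `krRate (D β₀W K₂)` for all `0 ≤ β ≤ β₀W/2` (radius and Dobrushin constant are monotone in `β`).
[cite: Creutz2022, Ch. 9, eq. (9.19), p. 44] [cite: Follmer1988, Ch. I Theorem (2.13)] -/
theorem forestDobrushinDoor_of_gaugeFixing_of_frozenClustering
    (hF2 : ForestGaugeFixing (G := Matrix.specialUnitaryGroup (Fin 2) ℂ) (fundamentalRep (Fin 2)))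
    (hF3 : FrozenForestClustering) : ForestDobrushinDoor := by
  intro D β₀W K₂ hK₂ hβ₀ hcomb hmod hsmall
  obtain ⟨S₀, hS₀⟩ := hcomb
  classical
  have hch : ∀ S : ℕ, ∃ F : Finset (Edge 4 (2 * S + 1)), ∃ rk : Site 4 (2 * S + 1) → ℕ,
      S₀ ≤ S → IsRankedForest F rk ∧ ForestRowBound F D := by
    intro S
    by_cases hS : S₀ ≤ S
    · obtain ⟨F, rk, h1, h2⟩ := hS₀ S hS
      exact ⟨F, rk, fun _ => ⟨h1, h2⟩⟩
    · exact ⟨∅, fun _ => 0, fun h => absurd h hS⟩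
  choose Fs rks hforest using hch
  refine ⟨krRate ((D : ℝ) * β₀W * K₂), krRate_pos hsmall, fun β hβ0 hββ₀ => ?_⟩
  have hβabs : |β| = β := abs_of_nonneg hβ0
  have hD : (0 : ℝ) ≤ D := Nat.cast_nonneg D
  refine exponentialClustering_of_frozen (N := 2) (by norm_num) hF2 hF3 Fs rks S₀ hforest (K := 4 * K₂)
    (by positivity) (R := 3 * β₀W / 2) ?_ hmod ?_ hsmall
  · rw [hβabs]; push_cast; linarith
  · rw [hβabs]; push_cast
    have key : 0 ≤ (D : ℝ) * K₂ * (β₀W - 2 * β) := mul_nonneg (mul_nonneg hD hK₂) (by linarith)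
    nlinarith [key]

/-- **The 4/15 what-if with its three rungs apart**: forest gauge fixing (F2), frozen-forest clustering (F3) and the
quarter modulus up to `κ = 1.6` (F4) put the `SU(2)` strong-coupling front at every `β₀W < 4/15` — through leaf
(25)'s kernel theorem `eventualForestRowBound_fifteen` (F1-15).  All three hypotheses are open obligation nodes;
nothing is asserted. [cite: Creutz2022, Ch. 9, eq. (9.19), p. 44] [cite: arXiv220412737, remark after Thm. 1.3 (Dobrushin route, p. 5)] -/
theorem su2_strongCouplingFront_whatIf15_of_rungs
    (hF2 : ForestGaugeFixing (G := Matrix.specialUnitaryGroup (Fin 2) ℂ) (fundamentalRep (Fin 2)))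
    (hF3 : FrozenForestClustering) (hF4 : QuarterModulusUpTo (4 / 15)) {β₀W : ℝ} (h0 : 0 ≤ β₀W)
    (hlt : β₀W < 4 / 15) :
    CrossoverLedger.StrongCouplingFront (fundamentalLatticeRep 2) (β₀W / 2) :=
  su2_strongCouplingFront_whatIf15 (forestDobrushinDoor_of_gaugeFixing_of_frozenClustering hF2 hF3) hF4 h0 hlt

end Summit.QuantumFields.BalabanUV.InfraRed.StrongCouplingForestDoorAssembly
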